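import Summits.AtomisticToContinuum.Crystallization.Theorems.ReggeStarCoercivityDefectFreeCrystallizesLayeredGluing11
/-!
# Part 12 of the proof of `stub_layeredGluing : LayeredGluing` (S5a, line `prestress-split-korn`, crux stmt-AtomisticToContinuum-13603); see the module docstring of the final part `ReggeStarCoercivityDefectFreeCrystallizesLayeredGluing.lean` for the overview
-/
noncomputable section
open scoped BigOperators Classical InnerProductSpace
open Filter Topology

namespace Summit.AtomisticToContinuum.Crystallization.Theorems.PrestressSplitKorn

open Summit.AtomisticToContinuum.Crystallization.Theses
open Summit.AtomisticToContinuum.Crystallization.Theses.ReggeStarCoercivity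
open Summit.AtomisticToContinuum.Crystallization.Theorems.DefectFreeCrystallizes.Negative.PredicateAPI
open Literature.MathematicalPhysics.StatisticalMechanics Literature.Geometry.DiscreteGeometry

section Sites

variable {a : ℝ} {s : ℤ → ℤ} {z : ℤ → ℝ}

section Slab

variable {a : ℝ} {s : ℤ → ℤ} {z : ℤ → ℝ} {Y : Set (EuclideanSpace ℝ (Fin 3))}

/-- **The half-known structure one layer up.** -/
theorem halfFramedAt_up {p : EuclideanSpace ℝ (Fin 3)} (hL : LayerFramed a Y p) (hp : FramedAt a Y p s z) :
    HalfFramedAt a Y (p + layeredPos a s z (1, 0, 0)) (fun k => s (k + 1)) (fun k => z (k + 1) - z 1) := by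
  have hp' := hp
  obtain ⟨hbox, hs, hz0, -, -⟩ := hp
  have hsh : ∀ l, layeredPos a (fun k => s (k + 1)) (fun k => z (k + 1) - z 1) l =
      layeredPos a s z (l + (1, 0, 0)) - layeredPos a s z (1, 0, 0) := fun l => layeredPos_shift a s z (1, 0, 0) l
  have hbox1 : InBox a (fun k => z (k + 1) - z 1) := hbox.shift 1
  have hz1 := hbox.z_one hz0
  have hz2 := hbox.z_two hz0
  refine ⟨hbox1, isHaggSeq_shift hs 1, by simp, ?_, ?_⟩
  · intro y hy hd hh
    simp only [PiLp.add_apply, layeredPos_apply_two] at hh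
    rw [show (1 : ℤ) + 1 = 2 by norm_num] at hh
    have habs : |y 2 - p 2| < 7 / 4 := by
      have h1 : |y 2 - (p + layeredPos a s z (1, 0, 0)) 2| < 2 := by
        have := (show |(y - (p + layeredPos a s z (1, 0, 0))) 2| ≤ ‖y - (p + layeredPos a s z (1, 0, 0))‖ by simpa only [Real.norm_eq_abs] using PiLp.norm_apply_le (y - (p + layeredPos a s z (1, 0, 0))) 2)
        rw [PiLp.sub_apply] at this
        rw [dist_eq_norm] at hd
        linarith
      simp only [PiLp.add_apply, layeredPos_apply_two] at h1
      rw [abs_lt] at h1 ⊢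
      constructor <;> linarith [h1.1, hz1.1, hz1.2, hz2.2, hbox.2.1, hbox.1]
    obtain ⟨l, -, hl⟩ := slab_exact hL hp' hy habs
    refine ⟨l - (1, 0, 0), ?_⟩
    rw [hsh, sub_add_cancel, hl]
    abel
  · intro l hl hl1
    rw [hsh, show p + layeredPos a s z (1, 0, 0) + (layeredPos a s z (l + (1, 0, 0)) - layeredPos a s z (1, 0, 0)) =
      p + layeredPos a s z (l + (1, 0, 0)) by abel]
    apply slab_mem hL hp'
    have habs := (hbox1.abs_z_le (by simp) l.1).2
    have hn : |z (l.1 + 1) - z 1| < 2 := by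
      have := (show |(layeredPos a (fun k => s (k + 1)) (fun k => z (k + 1) - z 1) l) 2| ≤ ‖layeredPos a (fun k => s (k + 1)) (fun k => z (k + 1) - z 1) l‖ by simpa only [Real.norm_eq_abs] using PiLp.norm_apply_le (layeredPos a (fun k => s (k + 1)) (fun k => z (k + 1) - z 1) l) 2)
      rw [layeredPos_apply_two] at this
      exact lt_of_le_of_lt this hl
    have h3 : |(l.1 : ℝ)| < 3 := by linarith
    rw [← Int.cast_abs] at h3
    have : |l.1| < 3 := by exact_mod_cast h3
    simp only [Prod.fst_add]
    rw [abs_lt] at this; omega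

/-! ### From `ExactNear` to a based template, and the upward induction -/

/-- Normal form of `ExactNear` at a point of `Y`: a template BASED at the point, in some frame. -/
theorem exactNear_templateAt {q : EuclideanSpace ℝ (Fin 3)} (h : ExactNear Y q) (hq : q ∈ Y) :
    ∃ (E : EuclideanSpace ℝ (Fin 3) ≃ₗᵢ[ℝ] (EuclideanSpace ℝ (Fin 3))) (a' : ℝ) (s' : ℤ → ℤ) (z' : ℤ → ℝ), TemplateAt Y q E a' s' z' := by
  obtain ⟨A, t, a', s', z', hbox, hs, h1, h2⟩ := h
  obtain ⟨l₀, hl₀⟩ := h1 q hq (by simp)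
  set E : EuclideanSpace ℝ (Fin 3) ≃ₗᵢ[ℝ] (EuclideanSpace ℝ (Fin 3)) := A.toLinearIsometryEquiv rfl with hE
  have hEA : ∀ x, E x = A x := fun x => rfl
  refine ⟨E, a', fun k => s' (k + l₀.1), fun k => z' (k + l₀.1) - z' l₀.1, hbox.shift _, isHaggSeq_shift hs _,
    by simp, ?_, ?_⟩
  · intro y hy hd
    obtain ⟨l, hl⟩ := h1 y hy hd
    refine ⟨l - l₀, ?_⟩
    rw [hEA, layeredPos_shift, sub_add_cancel, map_sub, ← hl, ← hl₀]
    abel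
  · intro l hl
    have key : A (layeredPos a' (fun k => s' (k + l₀.1)) (fun k => z' (k + l₀.1) - z' l₀.1) l) =
        A (layeredPos a' s' z' (l + l₀)) - (q + t) := by
      rw [layeredPos_shift, map_sub, hl₀]
    have hd : dist (A (layeredPos a' s' z' (l + l₀))) (q + t) < 2 := by
      rw [dist_eq_norm, ← key, LinearIsometry.norm_map]; exact hl
    have := h2 (l + l₀) hd
    rw [hEA, key]
    convert this using 1
    abel

/-- Auxiliary step `LayerFramed.shift` of the proof of `stub_layeredGluing` (S5a); see the final part's module docstring. -/
theorem LayerFramed.shift {p : EuclideanSpace ℝ (Fin 3)} (hL : LayerFramed a Y p) (i j : ℤ) :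
    LayerFramed a Y (p + ((i : ℝ) • triangularVec₁ a + (j : ℝ) • triangularVec₂ a)) := by
  intro i' j'
  obtain ⟨s, z, h⟩ := hL (i + i') (j + j')
  refine ⟨s, z, ?_⟩
  have e : p + ((i : ℝ) • triangularVec₁ a + (j : ℝ) • triangularVec₂ a) +
      ((i' : ℝ) • triangularVec₁ a + (j' : ℝ) • triangularVec₂ a) =
      p + (((i + i' : ℤ) : ℝ) • triangularVec₁ a + ((j + j' : ℤ) : ℝ) • triangularVec₂ a) := by
    push_cast; module
  rw [e]; exact h

/-- **One layer up.** If the layer of `p` is framed, so is the layer above it. -/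
theorem layerFramed_up (hE : ∀ q ∈ Y, ExactNear Y q) {p : EuclideanSpace ℝ (Fin 3)} (hL : LayerFramed a Y p)
    (hp : FramedAt a Y p s z) : LayerFramed a Y (p + layeredPos a s z (1, 0, 0)) := by
  intro i j
  obtain ⟨sx, zx, hx⟩ := hL i j
  have hLx := hL.shift i j
  have hH := halfFramedAt_up hLx hx
  have hd := layer_data_const hL hp i j hx
  have e1 : layeredPos a sx zx (1, 0, 0) = layeredPos a s z (1, 0, 0) := by
    rw [layeredPos_one, layeredPos_one, hd.1, hd.2.1]
  rw [e1] at hH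
  have e2 : p + ((i : ℝ) • triangularVec₁ a + (j : ℝ) • triangularVec₂ a) + layeredPos a s z (1, 0, 0) =
      p + layeredPos a s z (1, 0, 0) + ((i : ℝ) • triangularVec₁ a + (j : ℝ) • triangularVec₂ a) := by abel
  rw [e2] at hH
  have hmem : p + layeredPos a s z (1, 0, 0) + ((i : ℝ) • triangularVec₁ a + (j : ℝ) • triangularVec₂ a) ∈ Y := by
    have := hH.2.2.2.2 (0, 0, 0) (by rw [show ((0 : ℤ), (0 : ℤ), (0 : ℤ)) = (0 : ℤ × ℤ × ℤ) from rfl,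
      show (0 : ℤ × ℤ × ℤ) = ((0 : ℤ), (0 : ℤ), (0 : ℤ)) from rfl, layeredPos_origin (by simp)]; norm_num) (by norm_num)
    rwa [show ((0 : ℤ), (0 : ℤ), (0 : ℤ)) = (0 : ℤ × ℤ × ℤ) from rfl,
      show (0 : ℤ × ℤ × ℤ) = ((0 : ℤ), (0 : ℤ), (0 : ℤ)) from rfl, layeredPos_origin (by simp), add_zero] at this
  obtain ⟨E, a', s', z', hT⟩ := exactNear_templateAt (hE _ hmem) hmem
  exact generic_step hH hT

/-- **The upper half is framed.** From a framed layer, every point of `Y` at or above it carries an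
identity-framed template. -/
theorem framed_above (hE : ∀ q ∈ Y, ExactNear Y q) {p₀ : EuclideanSpace ℝ (Fin 3)} (hL : LayerFramed a Y p₀) :
    ∀ y ∈ Y, p₀ 2 ≤ y 2 → ∃ (s : ℤ → ℤ) (z : ℤ → ℝ), FramedAt a Y y s z := by
  classical
  -- one step as a total function
  have key : ∀ p : EuclideanSpace ℝ (Fin 3), ∃ p' : EuclideanSpace ℝ (Fin 3), LayerFramed a Y p → LayerFramed a Y p' ∧
      (∃ (s : ℤ → ℤ) (z : ℤ → ℝ), FramedAt a Y p s z ∧ p' = p + layeredPos a s z (1, 0, 0)) := by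
    intro p
    by_cases hp : LayerFramed a Y p
    · obtain ⟨s, z, h⟩ := hp.base
      exact ⟨p + layeredPos a s z (1, 0, 0), fun _ => ⟨layerFramed_up hE hp h, s, z, h, rfl⟩⟩
    · exact ⟨p, fun h => absurd h hp⟩
  choose F hF using key
  let b : ℕ → EuclideanSpace ℝ (Fin 3) := fun n => F^[n] p₀
  have b_succ : ∀ n, b (n + 1) = F (b n) := fun n => Function.iterate_succ_apply' F n p₀
  have hb : ∀ n, LayerFramed a Y (b n) := by
    intro n
    induction n with
    | zero => exact hL
    | succ n ih => rw [b_succ]; exact (hF _ ih).1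
  -- heights
  have hstep : ∀ n, ∃ (s : ℤ → ℤ) (z : ℤ → ℝ), FramedAt a Y (b n) s z ∧ b (n + 1) = b n + layeredPos a s z (1, 0, 0) := by
    intro n; rw [b_succ]; exact (hF _ (hb n)).2
  obtain ⟨s₀, z₀, h₀, -⟩ := hstep 0
  have ha : 0 < a := h₀.1.a_pos
  have hinc : ∀ n, 39 / 50 * a ≤ (b (n + 1)) 2 - (b n) 2 := by
    intro n
    obtain ⟨s, z, h, he⟩ := hstep n
    rw [he]
    simp only [PiLp.add_apply, layeredPos_apply_two]
    linarith [(h.1.z_one h.2.2.1).1]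
  have hgrow : ∀ n : ℕ, (b 0) 2 + 39 / 50 * a * n ≤ (b n) 2 := by
    intro n
    induction n with
    | zero => simp
    | succ n ih => have := hinc n; push_cast; linarith
  intro y hy hy0
  have hb0 : b 0 = p₀ := rfl
  obtain ⟨N, hN⟩ : ∃ N : ℕ, y 2 < (b (N + 1)) 2 := by
    obtain ⟨N, hN⟩ := exists_nat_gt ((y 2 - p₀ 2) / (39 / 50 * a))
    refine ⟨N, ?_⟩
    have := hgrow (N + 1)
    rw [div_lt_iff₀ (by positivity)] at hN
    rw [hb0] at this
    push_cast at this
    nlinarith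
  have hex : ∃ n : ℕ, y 2 < (b (n + 1)) 2 := ⟨N, hN⟩
  let n := Nat.find hex
  have hn1 : y 2 < (b (n + 1)) 2 := Nat.find_spec hex
  have hn0 : (b n) 2 ≤ y 2 := by
    rcases Nat.eq_zero_or_pos n with h | h
    · rw [h]; exact hy0
    · have := Nat.find_min hex (m := n - 1) (by omega)
      rw [show n - 1 + 1 = n by omega] at this
      linarith
  obtain ⟨s, z, hbn, he⟩ := hstep n
  have hyeq : y 2 = (b n) 2 := by
    rcases eq_or_lt_of_le hn0 with h | h
    · exact h.symm
    · exfalso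
      apply (no_between (hb n) hbn hy).1
      refine ⟨h, ?_⟩
      rw [he] at hn1
      simpa only [PiLp.add_apply, layeredPos_apply_two] using hn1
  obtain ⟨i, j, hij⟩ := layer_exact (hb n) hy hyeq
  obtain ⟨s', z', h'⟩ := hb n i j
  exact ⟨s', z', by rw [hij]; exact h'⟩

/-! ### Transport under isometries; the vertical reflection -/

/-- Auxiliary step `ExactNear.map` of the proof of `stub_layeredGluing` (S5a); see the final part's module docstring. -/
theorem ExactNear.map {Y : Set (EuclideanSpace ℝ (Fin 3))} {p : EuclideanSpace ℝ (Fin 3)} (h : ExactNear Y p) (R : EuclideanSpace ℝ (Fin 3) ≃ₗᵢ[ℝ] (EuclideanSpace ℝ (Fin 3))) (c : EuclideanSpace ℝ (Fin 3)) :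
    ExactNear ((fun y => R y + c) '' Y) (R p + c) := by
  obtain ⟨A, t, a', s', z', hbox, hs, h1, h2⟩ := h
  refine ⟨R.toLinearIsometry.comp A, R t - c, a', s', z', hbox, hs, ?_, ?_⟩
  · rintro _ ⟨y, hy, rfl⟩ hd
    have hd' : dist y p < 2 := by
      rw [dist_eq_norm] at hd ⊢
      rw [show R y + c - (R p + c) = R (y - p) by rw [map_sub]; abel, LinearIsometryEquiv.norm_map] at hd
      exact hd
    obtain ⟨l, hl⟩ := h1 y hy hd'
    refine ⟨l, ?_⟩
    simp only [LinearIsometry.coe_comp, Function.comp_apply, LinearIsometryEquiv.coe_toLinearIsometry]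
    rw [← hl, map_add]; abel
  · intro l hd
    simp only [LinearIsometry.coe_comp, Function.comp_apply, LinearIsometryEquiv.coe_toLinearIsometry] at hd ⊢
    have hd' : dist (A (layeredPos a' s' z' l)) (p + t) < 2 := by
      rw [dist_eq_norm] at hd ⊢
      rw [show R (A (layeredPos a' s' z' l)) - (R p + c + (R t - c)) = R (A (layeredPos a' s' z' l) - (p + t)) by
        rw [map_sub, map_add]; abel, LinearIsometryEquiv.norm_map] at hd
      exact hd
    have := h2 l hd'
    refine ⟨_, this, ?_⟩
    simp only [map_sub]; abel

/-- Auxiliary step `reflectZ_layerNormal` of the proof of `stub_layeredGluing` (S5a); see the final part's module docstring. -/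
theorem reflectZ_layerNormal : reflectZ (layerNormal 1) = -layerNormal 1 :=
  Submodule.reflection_orthogonalComplement_singleton_eq_neg _

/-- Auxiliary step `reflectZ_of_horizontal` of the proof of `stub_layeredGluing` (S5a); see the final part's module docstring. -/
theorem reflectZ_of_horizontal {x : EuclideanSpace ℝ (Fin 3)} (hx : x 2 = 0) : reflectZ x = x := by
  apply Submodule.reflection_mem_subspace_eq_self
  rw [Submodule.mem_orthogonal_singleton_iff_inner_right, real_inner_fin3]
  simp [layerNormal, hx]

/-- Auxiliary step `reflectZ_u` of the proof of `stub_layeredGluing` (S5a); see the final part's module docstring. -/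
theorem reflectZ_u (a : ℝ) : reflectZ (triangularVec₁ a) = triangularVec₁ a :=
  reflectZ_of_horizontal (by simp [triangularVec₁])

/-- Auxiliary step `reflectZ_v` of the proof of `stub_layeredGluing` (S5a); see the final part's module docstring. -/
theorem reflectZ_v (a : ℝ) : reflectZ (triangularVec₂ a) = triangularVec₂ a :=
  reflectZ_of_horizontal (by simp [triangularVec₂])

/-- Auxiliary step `reflectZ_symm` of the proof of `stub_layeredGluing` (S5a); see the final part's module docstring. -/
theorem reflectZ_symm : reflectZ.symm = reflectZ := Submodule.reflection_symm

/-- Auxiliary step `reflectZ_reflectZ` of the proof of `stub_layeredGluing` (S5a); see the final part's module docstring. -/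
theorem reflectZ_reflectZ (x : EuclideanSpace ℝ (Fin 3)) : reflectZ (reflectZ x) = x := by
  conv_lhs => rw [← reflectZ_symm]
  exact LinearIsometryEquiv.symm_apply_apply _ _

/-- Auxiliary step `reflectZ_image_image` of the proof of `stub_layeredGluing` (S5a); see the final part's module docstring. -/
theorem reflectZ_image_image (Y : Set (EuclideanSpace ℝ (Fin 3))) : reflectZ '' (reflectZ '' Y) = Y := by
  ext y; constructor
  · rintro ⟨_, ⟨x, hx, rfl⟩, rfl⟩; rwa [reflectZ_reflectZ]
  · intro hy; exact ⟨reflectZ y, ⟨y, hy, rfl⟩, reflectZ_reflectZ y⟩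

/-- Auxiliary step `reflectZ_apply_two` of the proof of `stub_layeredGluing` (S5a); see the final part's module docstring. -/
theorem reflectZ_apply_two (x : EuclideanSpace ℝ (Fin 3)) : (reflectZ x) 2 = -x 2 := by
  have h := inner_frame_two reflectZ x
  rw [reflectZ_symm, reflectZ_layerNormal, inner_neg_right, real_inner_fin3] at h
  simp [layerNormal] at h
  exact h

/-- A framing reflects to a framing (with reflected data). -/
theorem FramedAt.reflect {p : EuclideanSpace ℝ (Fin 3)} (hp : FramedAt a Y p s z) :
    ∃ (s' : ℤ → ℤ) (z' : ℤ → ℝ), FramedAt a (reflectZ '' Y) (reflectZ p) s' z' := by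
  obtain ⟨hbox, hs, hz0, h1, h2⟩ := hp
  have ha := hbox.a_pos
  obtain ⟨s'', z'', hbox'', hs'', hz0'', hfwd, hbwd⟩ := reexpress reflectZ ha
    ⟨1, 0, by rw [reflectZ_u]; simp⟩ ⟨0, 1, by rw [reflectZ_v]; simp⟩
    ⟨1, 0, by rw [reflectZ_symm, reflectZ_u]; simp⟩ ⟨0, 1, by rw [reflectZ_symm, reflectZ_v]; simp⟩
    (Or.inr rfl) (by rw [reflectZ_layerNormal, neg_one_smul]) hbox hs hz0
  refine ⟨s'', z'', hbox'', hs'', hz0'', ?_, ?_⟩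
  · rintro _ ⟨y, hy, rfl⟩ hd
    have hd' : dist y p < 2 := by
      rw [dist_eq_norm, ← map_sub, LinearIsometryEquiv.norm_map, ← dist_eq_norm] at hd; exact hd
    obtain ⟨l, hl⟩ := h1 y hy hd'
    obtain ⟨l'', hl''⟩ := hfwd l
    exact ⟨l'', by rw [hl, map_add, hl'']⟩
  · intro l'' hl''
    obtain ⟨l, hl⟩ := hbwd l''
    have hn : ‖layeredPos a s z l‖ < 2 := by rw [← LinearIsometryEquiv.norm_map reflectZ, ← hl]; exact hl''
    refine ⟨p + layeredPos a s z l, h2 l hn, ?_⟩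
    rw [map_add, hl]

/-- Auxiliary step `LayerFramed.reflect` of the proof of `stub_layeredGluing` (S5a); see the final part's module docstring. -/
theorem LayerFramed.reflect {p : EuclideanSpace ℝ (Fin 3)} (hL : LayerFramed a Y p) : LayerFramed a (reflectZ '' Y) (reflectZ p) := by
  intro i j
  obtain ⟨s, z, h⟩ := hL i j
  obtain ⟨s', z', h'⟩ := h.reflect
  refine ⟨s', z', ?_⟩
  rw [map_add, map_add, LinearIsometryEquiv.map_smul, LinearIsometryEquiv.map_smul, reflectZ_u, reflectZ_v] at h'
  exact h'

/-- **All of `Y` is framed** once one layer is framed (upwards directly, downwards by reflection). -/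
theorem allFramed_of_layerFramed (hE : ∀ q ∈ Y, ExactNear Y q) {p₀ : EuclideanSpace ℝ (Fin 3)} (hL : LayerFramed a Y p₀) :
    AllFramed a Y := by
  intro y hy
  rcases le_or_gt (p₀ 2) (y 2) with h | h
  · exact framed_above hE hL y hy h
  · -- reflect
    have hE' : ∀ q ∈ reflectZ '' Y, ExactNear (reflectZ '' Y) q := by
      rintro _ ⟨q, hq, rfl⟩
      have := (hE q hq).map reflectZ 0
      simp only [add_zero] at this
      convert this using 2
    have hL' := hL.reflect
    obtain ⟨s', z', h'⟩ := framed_above hE' hL' (reflectZ y) ⟨y, hy, rfl⟩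
      (by rw [reflectZ_apply_two, reflectZ_apply_two]; linarith)
    obtain ⟨s'', z'', h''⟩ := h'.reflect
    rw [reflectZ_reflectZ, reflectZ_image_image] at h''
    exact ⟨s'', z'', h''⟩

end Slab

/-! ## Stage A: in-plane steps along the base layer -/

section StageA

variable {a : ℝ} {s : ℤ → ℤ} {z : ℤ → ℝ} {Y : Set (EuclideanSpace ℝ (Fin 3))} {x : EuclideanSpace ℝ (Fin 3)} {xe : ℤ × ℤ × ℤ}
  {E : EuclideanSpace ℝ (Fin 3) ≃ₗᵢ[ℝ] (EuclideanSpace ℝ (Fin 3))} {a' : ℝ} {s' : ℤ → ℤ} {z' : ℤ → ℝ}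

/-- Auxiliary step `hex_add_hex_Q` of the proof of `stub_layeredGluing` (S5a); see the final part's module docstring. -/
theorem hex_add_hex_Q : ∀ l ∈ hexLabels, ∀ x ∈ hexLabels, l ≠ x →
    (l.2.1 + x.2.1) ^ 2 + (l.2.1 + x.2.1) * (l.2.2 + x.2.2) + (l.2.2 + x.2.2) ^ 2 ≤ 3 := by decide

/-- Auxiliary step `up_add_hex_Q` of the proof of `stub_layeredGluing` (S5a); see the final part's module docstring. -/
theorem up_add_hex_Q : ∀ σ ∈ ({1, -1} : Finset ℤ), ∀ l ∈ upLabels σ, ∀ x ∈ hexLabels,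
    3 * ((l.2.1 + x.2.1) ^ 2 + (l.2.1 + x.2.1) * (l.2.2 + x.2.2) + (l.2.2 + x.2.2) ^ 2 +
      σ * ((l.2.1 + x.2.1) + (l.2.2 + x.2.2))) + 1 ≤ 7 := by decide

/-- Auxiliary step `down_add_hex_Q` of the proof of `stub_layeredGluing` (S5a); see the final part's module docstring. -/
theorem down_add_hex_Q : ∀ σ ∈ ({1, -1} : Finset ℤ), ∀ l ∈ downLabels σ, ∀ x ∈ hexLabels,
    3 * ((l.2.1 + x.2.1) ^ 2 + (l.2.1 + x.2.1) * (l.2.2 + x.2.2) + (l.2.2 + x.2.2) ^ 2 -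
      σ * ((l.2.1 + x.2.1) + (l.2.2 + x.2.2))) + 1 ≤ 7 := by decide

/-- Adding a hexagon label shifts a site within its layer. -/
theorem layeredPos_add_hex (hz0 : z 0 = 0) (hxe : xe ∈ hexLabels) (l : ℤ × ℤ × ℤ) :
    layeredPos a s z (l + xe) = layeredPos a s z l + layeredPos a s z xe := by
  obtain ⟨m, i, j⟩ := l
  obtain ⟨m', i', j'⟩ := xe
  have := hexLabels_fst hxe
  simp only at this
  subst this
  rw [layeredPos_of_mem_hexLabels hz0 hxe]
  simp only [Prod.mk_add_mk, add_zero, layeredPos]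
  push_cast; module

/-- A neighbour site shifted by a hexagon vector other than itself stays in the open 2-ball. -/
theorem norm_nbr_add_hex_lt (hbox : InBox a z) (hs : IsHaggSeq s) (hz0 : z 0 = 0) {l : ℤ × ℤ × ℤ}
    (hl : l ∈ nbrLabels s) (hxe : xe ∈ hexLabels) (hne : l ≠ xe) : ‖layeredPos a s z (l + xe)‖ < 2 := by
  have ha := hbox.a_pos
  have ha1 := hbox.2.1
  obtain ⟨m, i, j⟩ := l
  obtain ⟨m', i', j'⟩ := xe
  have hm' := hexLabels_fst hxe
  simp only at hm'
  subst hm'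
  apply norm_lt_two_of_sq
  simp only [Prod.mk_add_mk, add_zero]
  rw [norm_sq_layeredPos]
  rcases mem_nbrLabels.1 hl with h | h | h
  · have hm := hexLabels_fst h; simp only at hm; subst hm
    have hQ := hex_add_hex_Q _ h _ hxe hne
    simp only at hQ
    have hQr : ((i + i' : ℤ) : ℝ) ^ 2 + (i + i') * (j + j') + ((j + j' : ℤ) : ℝ) ^ 2 ≤ 3 := by exact_mod_cast hQ
    push_cast at hQr ⊢
    simp only [haggLabel_zero, hz0, Int.cast_zero]
    nlinarith
  · have hm := upLabels_fst h; simp only at hm; subst hm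
    have hσ : s 0 ∈ ({1, -1} : Finset ℤ) := by rcases hs 0 with h' | h' <;> simp [h']
    have hQ := up_add_hex_Q _ hσ _ h _ hxe
    simp only at hQ
    have hQr : 3 * (((i + i' : ℤ) : ℝ) ^ 2 + (i + i') * (j + j') + ((j + j' : ℤ) : ℝ) ^ 2 +
        (s 0 : ℝ) * ((i + i') + (j + j'))) + 1 ≤ 7 := by exact_mod_cast hQ
    have hσ2 : ((s 0 : ℤ) : ℝ) ^ 2 = 1 := by rcases hs 0 with h' | h' <;> simp [h']
    have hz1 := hbox.z_one hz0
    push_cast at hQr ⊢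
    simp only [haggLabel_one]
    nlinarith [hz1.1, hz1.2]
  · have hm := downLabels_fst h; simp only at hm; subst hm
    have hσ : s (-1) ∈ ({1, -1} : Finset ℤ) := by rcases hs (-1) with h' | h' <;> simp [h']
    have hQ := down_add_hex_Q _ hσ _ h _ hxe
    simp only at hQ
    have hQr : 3 * (((i + i' : ℤ) : ℝ) ^ 2 + (i + i') * (j + j') + ((j + j' : ℤ) : ℝ) ^ 2 -
        (s (-1) : ℝ) * ((i + i') + (j + j'))) + 1 ≤ 7 := by exact_mod_cast hQ
    have hσ2 : ((s (-1) : ℤ) : ℝ) ^ 2 = 1 := by rcases hs (-1) with h' | h' <;> simp [h']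
    have hz1 := hbox.z_neg_one hz0
    push_cast at hQr ⊢
    simp only [haggLabel_neg_one, Int.cast_neg]
    nlinarith [hz1.1, hz1.2]

/-- Landing anchor of this file (registered stub of crux stmt-AtomisticToContinuum-13603; re-exports a result above). -/
theorem layeredGluing_part12_anchor :
    reflectZ (layerNormal 1) = -layerNormal 1 :=
  reflectZ_layerNormal

end StageA
end Sites

end Summit.AtomisticToContinuum.Crystallization.Theorems.PrestressSplitKorn
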